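import Literature.NumberTheory.NumberFields.ImaginaryAbelianFieldOddChiClassNumberBridge
import Literature.NumberTheory.NumberFields.QuadraticExtensionFrobeniusProofs
import HarnessLib

/-!
# Route `PrintCFram`, crux C2 `BottomClassIndexLawFiveLe` (stmt-BirchSwinnertonDyer-20372), line `eisenstein-resource-bdp-line`
# v13 (LEAD g9, Road C), stub `stub_lineDictionary`: THE FROBENIUS MATCHING FOR THE QUADRATIC CHARACTER
# (cell `bsd-print-cfram`, seat `bsd-line-cfram-p1-w6` g0; helper `--supports` 20372; 0 facts, 0 defs)

HONEST FRAMING. Nothing about BSD is proved here; no summit statement is proved by this seat. LEAD g9's request (STATUS 18:49Z): for a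
quadratic Galois number field `K/ℚ`, the quadratic Galois character `ε : Γ_ℚ → 𝔽_pˣ` (`ker ε = res(Γ_K)`, w4 g5's
`exists_quadraticCharacter`), a prime `ℓ ∤ d_K`, a prime `𝔓` of `\bar ℤ` above `ℓ` and an arithmetic Frobenius `τ ∈ Γ_ℚ` at `𝔓`:

  **`ε τ = 1 ↔ ℓ` splits in `K`** (`((ℓ).primesOver 𝓞_K).ncard = 2`, the idiom of `KrizLi2019.IsKroneckerCharacterOf`).

Mechanism (no Chebotarev): `τ̄ = absGaloisQuot ℚ K τ` is an arithmetic Frobenius at `Q = 𝔓 ∩ 𝓞_K` (this seat's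
`isArithFrobAt_absGaloisQuot`, p652301); `τ̄ = 1` iff the residue field `𝓞_K/Q` satisfies `y^ℓ = y` identically iff `f(Q|ℓ) = 1`
(`card_le_of_forall_pow_eq`; uniqueness of Frobenius at an unramified prime, `eq_of_isArithFrobAt_of_not_dvd_discr`); and
`#{Q ∣ ℓ} · e · f = [K:ℚ] = 2` (Mathlib's fundamental identity) with `e = 1` (`ℓ ∤ d_K`). With w3 g4's (a) this turns
`IsKroneckerCharacterOf K εK` into the pointwise avatar `Teich(ε τ) = εK(χ_{|d_K|} τ)` of `stub_lineDictionary`.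

* `liesOver_span_of_natCast_mem`, `natCard_quot_eq_pow_inertiaDeg` — bookkeeping over `ℤ` (`#(ℤ/ℓ) = ℓ` is the tree's
  `HeckeThetaPartner.natCard_int_quot_span`, inlined here to keep the import light);
* `absGaloisQuot_eq_one_iff_inertiaDeg_eq_one` — `τ̄ = 1 ↔ f(𝔓 ∩ 𝓞_K | ℓ) = 1` (`K/ℚ` Galois, `ℓ ∤ d_K`);
* `ncard_primesOver_eq_two_iff_inertiaDeg_eq_one` — `[K:ℚ] = 2`, `ℓ ∤ d_K`: `ℓ` splits `↔ f = 1`;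
* **`quadraticCharacter_eq_one_iff_ncard_primesOver_eq_two`** — the requested statement.

THEOREMS ONLY; no definition, no named fact, no `sorry`; imports no `Theses` module.
References: [NeukirchANT1999] Ch. I §8 (8.2) (fundamental identity), §9 (9.4)–(9.6) (Frobenius); [Marcus2018] Ch. 4 Thm. 28;
[Cox2013] §5 Prop. 5.16 / §8 (ℓ splits in K ⟺ (d_K/ℓ) = 1 ⟺ Frob_ℓ trivial on K).
-/

set_option autoImplicit false
-- `…BirchSwinnertonDyer.BirchSwinnertonDyer.Theorems…` is the problem's mandated namespace (D-0017).
set_option linter.dupNamespace false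

noncomputable section

open NumberField Field IsDedekindDomain Ideal
open Literature.NumberTheory.GaloisRepresentations Literature.NumberTheory.NumberFields

namespace Summit.BirchSwinnertonDyer.BirchSwinnertonDyer.Theorems.PrintCFram.HerbrandQuadraticFrobenius

/-! ## §1 Bookkeeping over `ℤ` -/

variable {K : Type} [Field K] [NumberField K]

omit [NumberField K] in
/-- A prime `Q` of `𝓞 K` containing the rational prime `ℓ` lies over `(ℓ) ⊆ ℤ`. [folklore] -/
theorem liesOver_span_of_natCast_mem {ℓ : ℕ} (hℓ : ℓ.Prime) {Q : Ideal (𝓞 K)} [Q.IsPrime]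
    (hQ : (ℓ : 𝓞 K) ∈ Q) : Q.LiesOver (Ideal.span {(ℓ : ℤ)}) := by
  refine ⟨?_⟩
  have hprime : (Q.under ℤ).IsPrime := Ideal.IsPrime.under ℤ Q
  have hmax : (Ideal.span {(ℓ : ℤ)}).IsMaximal :=
    PrincipalIdealRing.isMaximal_of_irreducible (Nat.prime_iff_prime_int.mp hℓ).irreducible
  refine hmax.eq_of_le hprime.ne_top ?_
  rw [Ideal.span_le, Set.singleton_subset_iff, SetLike.mem_coe, Ideal.under_def, Ideal.mem_comap, map_natCast]
  exact hQ

/-- `#(𝓞 K / Q) = ℓ^{f(Q|ℓ)}` for a prime `Q ∋ ℓ` of `𝓞 K`. [cite: NeukirchANT1999, Ch. I §8 (before (8.2))] -/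
theorem natCard_quot_eq_pow_inertiaDeg {ℓ : ℕ} (hℓ : ℓ.Prime) {Q : Ideal (𝓞 K)} [Q.IsPrime]
    (hQ : (ℓ : 𝓞 K) ∈ Q) : Nat.card (𝓞 K ⧸ Q) = ℓ ^ Q.inertiaDeg ℤ := by
  haveI := liesOver_span_of_natCast_mem hℓ hQ
  haveI : (Ideal.span {(ℓ : ℤ)}).IsMaximal :=
    PrincipalIdealRing.isMaximal_of_irreducible (Nat.prime_iff_prime_int.mp hℓ).irreducible
  have hne : Q ≠ ⊥ := fun h => by
    rw [h, Ideal.mem_bot] at hQ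
    exact hℓ.ne_zero (by exact_mod_cast hQ)
  haveI : Q.IsMaximal := Ideal.IsPrime.isMaximal inferInstance hne
  have h := Ideal.cardQuot_pow_inertiaDeg (Ideal.span {(ℓ : ℤ)}) Q
  rw [Submodule.cardQuot_apply, Submodule.cardQuot_apply, Nat.card_congr (Int.quotientSpanNatEquivZMod ℓ).toEquiv,
    Nat.card_zmod] at h
  exact h.symm

/-! ## §2 `τ̄ = 1 ↔ f = 1` -/

variable [IsGalois ℚ K]

/-- **The Frobenius class of `ℓ ∤ d_K` in `Gal(K/ℚ)` is trivial iff `f(Q|ℓ) = 1`** for `Q = 𝔓 ∩ 𝓞_K`: `τ ∈ Γ_ℚ` an arithmetic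
Frobenius at the prime `𝔓` of `\bar ℤ` above `ℓ`. (`⟹`: `y^ℓ = y` on `𝓞_K/Q` bounds its size by `ℓ`; `⟸`: `1` is then a Frobenius at
`Q`, and Frobenii at an unramified prime are unique.) [cite: NeukirchANT1999, Ch. I §9 (9.4)–(9.6)] [cite: Marcus2018, Ch. 4 Thm. 28] -/
theorem absGaloisQuot_eq_one_iff_inertiaDeg_eq_one {ℓ : ℕ} (hℓ : ℓ.Prime) (hℓd : ¬ ((ℓ : ℤ) ∣ NumberField.discr K))
    {v : HeightOneSpectrum (𝓞 ℚ)} (hv : (ℓ : 𝓞 ℚ) ∈ v.asIdeal) {𝔓 : Ideal (absIntegers (𝓞 ℚ) ℚ)}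
    (h𝔓 : 𝔓 ∈ v.primesAbove) {τ : absoluteGaloisGroup ℚ} (hτ : IsArithFrobAt (𝓞 ℚ) τ 𝔓) :
    absGaloisQuot ℚ K τ = 1 ↔ (𝔓.comap (absEmbeddingInt ℚ K)).inertiaDeg ℤ = 1 := by
  classical
  haveI : 𝔓.IsPrime := h𝔓.1
  set Q : Ideal (𝓞 K) := 𝔓.comap (absEmbeddingInt ℚ K) with hQdef
  haveI hQp : Q.IsPrime := Ideal.IsPrime.comap _
  -- `ℓ ∈ Q`
  have hℓ𝔓 : ((ℓ : ℕ) : absIntegers (𝓞 ℚ) ℚ) ∈ 𝔓 := by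
    have h := Ideal.mem_comap.mp (h𝔓.2.over ▸ hv : (ℓ : 𝓞 ℚ) ∈ 𝔓.under (𝓞 ℚ))
    rwa [map_natCast] at h
  have hQℓ : (ℓ : 𝓞 K) ∈ Q := by
    rw [hQdef, Ideal.mem_comap, map_natCast]; exact hℓ𝔓
  haveI := liesOver_span_of_natCast_mem hℓ hQℓ
  have hne : Q ≠ ⊥ := fun h => by
    rw [h, Ideal.mem_bot] at hQℓ
    exact hℓ.ne_zero (by exact_mod_cast hQℓ)
  haveI : Q.IsMaximal := Ideal.IsPrime.isMaximal inferInstance hne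
  haveI : Finite (𝓞 K ⧸ Q) := Ideal.finiteQuotientOfFreeOfNeBot Q hne
  letI : Field (𝓞 K ⧸ Q) := Ideal.Quotient.field Q
  letI : Fintype (𝓞 K ⧸ Q) := Fintype.ofFinite _
  have hunder : Q.under ℤ = Ideal.span {(ℓ : ℤ)} := (Ideal.LiesOver.over (p := Ideal.span {(ℓ : ℤ)}) (P := Q)).symm
  have hexp : Nat.card (ℤ ⧸ Q.under ℤ) = ℓ := by
    rw [hunder, Nat.card_congr (Int.quotientSpanNatEquivZMod ℓ).toEquiv, Nat.card_zmod]
  have hcard : Fintype.card (𝓞 K ⧸ Q) = ℓ ^ Q.inertiaDeg ℤ := by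
    rw [← Nat.card_eq_fintype_card]; exact natCard_quot_eq_pow_inertiaDeg hℓ hQℓ
  have hσ := isArithFrobAt_absGaloisQuot K hℓ hv h𝔓 hτ
  rw [← hQdef] at hσ
  constructor
  · -- `τ̄ = 1`: every residue class satisfies `y^ℓ = y`
    intro h1
    have hall : ∀ y : 𝓞 K ⧸ Q, y ^ ℓ = y := by
      intro y
      obtain ⟨x, rfl⟩ := Ideal.Quotient.mk_surjective y
      have hx := hσ x
      rw [h1, MulSemiringAction.toAlgHom_apply, one_smul, hexp] at hx
      rw [← map_pow, eq_comm, Ideal.Quotient.eq]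
      exact hx
    have hle := card_le_of_forall_pow_eq hℓ.one_lt hall
    rw [hcard] at hle
    have hf0 : Q.inertiaDeg ℤ ≠ 0 := by
      intro h0
      rw [h0, pow_zero] at hcard
      have hsub : Subsingleton (𝓞 K ⧸ Q) := Fintype.card_le_one_iff_subsingleton.mp hcard.le
      exact hQp.ne_top (Ideal.Quotient.subsingleton_iff.mp hsub)
    by_contra hf1
    have h2 : 2 ≤ Q.inertiaDeg ℤ := by omega
    have := Nat.pow_le_pow_right hℓ.pos h2
    have hlt : ℓ < ℓ ^ 2 := by nlinarith [hℓ.one_lt]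
    omega
  · -- `f = 1`: `1` is a Frobenius at `Q`, and Frobenii at the unramified `Q` are unique
    intro hf
    rw [hf, pow_one] at hcard
    have h1 : IsArithFrobAt ℤ (1 : K ≃ₐ[ℚ] K) Q := by
      intro x
      rw [MulSemiringAction.toAlgHom_apply, one_smul, hexp, ← Ideal.Quotient.eq, map_pow, ← hcard, FiniteField.pow_card]
    let w : HeightOneSpectrum (𝓞 K) := ⟨Q, inferInstance, hne⟩
    exact eq_of_isArithFrobAt_of_not_dvd_discr K hℓ hℓd (w := w) hQℓ hσ h1

/-! ## §3 `ℓ` splits `↔ f = 1` in a quadratic field, and the requested matching -/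

/-- In a quadratic Galois field `K/ℚ` with `ℓ ∤ d_K`: `ℓ` splits (`#{Q ∣ ℓ} = 2`) iff `f(Q|ℓ) = 1` for one (any) `Q ∣ ℓ` — the
fundamental identity `#{Q ∣ ℓ}·e·f = 2` with `e = 1`. [cite: NeukirchANT1999, Ch. I §8 (8.2) and Cor. (8.4)] -/
theorem ncard_primesOver_eq_two_iff_inertiaDeg_eq_one (h2 : Module.finrank ℚ K = 2) {ℓ : ℕ} (hℓ : ℓ.Prime)
    (hℓd : ¬ ((ℓ : ℤ) ∣ NumberField.discr K)) (Q : Ideal (𝓞 K)) [Q.IsPrime] (hQ : (ℓ : 𝓞 K) ∈ Q) :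
    ((Ideal.span {(ℓ : ℤ)}).primesOver (𝓞 K)).ncard = 2 ↔ Q.inertiaDeg ℤ = 1 := by
  haveI := liesOver_span_of_natCast_mem hℓ hQ
  haveI : (Ideal.span {(ℓ : ℤ)}).IsPrime :=
    (Ideal.span_singleton_prime (by exact_mod_cast hℓ.ne_zero)).mpr (Nat.prime_iff_prime_int.mp hℓ)
  haveI : IsGaloisGroup (K ≃ₐ[ℚ] K) ℤ (𝓞 K) := IsGaloisGroup.of_isFractionRing (K ≃ₐ[ℚ] K) ℤ (𝓞 K) ℚ K
  -- `e(Q|ℓ) = 1`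
  have hunr : Algebra.IsUnramifiedAt ℤ Q :=
    (NumberField.not_dvd_discr_iff_forall_mem K (𝓞 K) (Nat.prime_iff_prime_int.mp hℓ)).mp hℓd Q inferInstance
      (by rw [Int.cast_natCast]; exact hQ)
  have he : Ideal.ramificationIdxIn (Ideal.span {(ℓ : ℤ)}) (𝓞 K) = 1 := by
    rw [Ideal.ramificationIdxIn_eq_ramificationIdx (Ideal.span {(ℓ : ℤ)}) Q (K ≃ₐ[ℚ] K)]
    exact (Ideal.ramificationIdx_eq_one_iff).mpr hunr
  have hid := Ideal.ncard_primesOver_mul_ramificationIdxIn_mul_inertiaDegIn (Ideal.span {(ℓ : ℤ)}) (𝓞 K) (K ≃ₐ[ℚ] K)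
  rw [he, one_mul, Ideal.inertiaDegIn_eq_inertiaDeg (Ideal.span {(ℓ : ℤ)}) Q (K ≃ₐ[ℚ] K),
    IsGalois.card_aut_eq_finrank, h2] at hid
  constructor
  · intro hn
    rw [hn] at hid
    omega
  · intro hf
    rw [hf, mul_one] at hid
    exact hid

/-- **THE FROBENIUS MATCHING FOR THE QUADRATIC CHARACTER (LEAD g9's request, v13 `stub_lineDictionary`).** `K/ℚ` quadratic Galois,
`ε : Γ_ℚ → 𝔽_pˣ` with `ker ε = res(Γ_K)`, `ℓ ∤ d_K` prime, `𝔓` a prime of `\bar ℤ` above `ℓ`, `τ` an arithmetic Frobenius at `𝔓`: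
**`ε τ = 1 ↔ ℓ` splits in `K`** (`((ℓ).primesOver 𝓞_K).ncard = 2`). [cite: NeukirchANT1999, Ch. I §8 (8.2), §9 (9.4)–(9.6)]
[cite: Cox2013, §5 Prop. 5.16] -/
theorem quadraticCharacter_eq_one_iff_ncard_primesOver_eq_two {p : ℕ} (h2 : Module.finrank ℚ K = 2)
    (ε : absoluteGaloisGroup ℚ →* (ZMod p)ˣ) (hεK : ∀ g, g ∈ (absGaloisRestrict ℚ K).range ↔ ε g = 1)
    {ℓ : ℕ} (hℓ : ℓ.Prime) (hℓd : ¬ ((ℓ : ℤ) ∣ NumberField.discr K))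
    {v : HeightOneSpectrum (𝓞 ℚ)} (hv : (ℓ : 𝓞 ℚ) ∈ v.asIdeal) {𝔓 : Ideal (absIntegers (𝓞 ℚ) ℚ)}
    (h𝔓 : 𝔓 ∈ v.primesAbove) {τ : absoluteGaloisGroup ℚ} (hτ : IsArithFrobAt (𝓞 ℚ) τ 𝔓) :
    ε τ = 1 ↔ ((Ideal.span {(ℓ : ℤ)}).primesOver (𝓞 K)).ncard = 2 := by
  haveI : 𝔓.IsPrime := h𝔓.1
  haveI : (𝔓.comap (absEmbeddingInt ℚ K)).IsPrime := Ideal.IsPrime.comap _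
  have hQℓ : (ℓ : 𝓞 K) ∈ 𝔓.comap (absEmbeddingInt ℚ K) := by
    have h := Ideal.mem_comap.mp (h𝔓.2.over ▸ hv : (ℓ : 𝓞 ℚ) ∈ 𝔓.under (𝓞 ℚ))
    rw [map_natCast] at h
    rw [Ideal.mem_comap, map_natCast]; exact h
  rw [← hεK, ← absGaloisQuot_eq_one_iff, absGaloisQuot_eq_one_iff_inertiaDeg_eq_one hℓ hℓd hv h𝔓 hτ,
    ncard_primesOver_eq_two_iff_inertiaDeg_eq_one h2 hℓ hℓd _ hQℓ]

end Summit.BirchSwinnertonDyer.BirchSwinnertonDyer.Theorems.PrintCFram.HerbrandQuadraticFrobenius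

end
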